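import Summits.QuantumFields.YangMills.Theorems.BalabanUVNodesN22KnitThreeLines
import Summits.QuantumFields.YangMills.Theorems.BalabanUVNodesN22KnitFiniteTower

/-!
# BalabanUVNodes ∕ N22 knit, ROAD 3 — THE TWO-CONSTANTS DERIVATIVE BOUND AND FADING MEMORY FROM ANALYTICITY AT ANY GEOMETRIC GROWTH:
# `‖F′(x₀)‖ ≤ (32∕(s²r))·ε^{1−s}(2B)^{s}` from ONE-SIDED real flatness `ε` and a disc bound `B` (every `s ∈ ]0,1[`), hence node N22 =
# `NE9 ∧ FadingMemory` BY NAME from (P) + (O) (node N18's tower rate `θ`) + uniform-margin analyticity of the young-coupling sections with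
# bounds `M·μ^{age}` growing at ANY geometric rate `μ` — fading at the rate `θ^{1−s}μ^{s}`, i.e. at EVERY rate above `θ` (Track A, DAG node
# N22 = NE9; cluster K4 «SpineRates»; seat `pub-ymgap-dag-n22-a`)

HONEST FRAMING.  §§1–2 are one-variable complex analysis ([folklore]); §3 is count-neutral kernel bookkeeping over hypothesis shapes on the
ABSTRACT carriers `T4OutputRate.Carriers` and ne9's tower of carriers; NOT a node discharge; NE5 ∕ NE9 NOT IN PRINT, NOT PROVED; instance on
Bałaban's localized `E^{(j)}(X)` 0∕1 (wall W1 unchanged); one finite four-torus programme at fixed ε; nothing continuum ∕ ℝ⁴ ∕ OS ∕ mass-gap ∕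
Clay.  0 `sorry`, 0 `def`, standard axioms.  `--supports` item `SpineGivenEndpoint` (route «BalabanUVNodes», cluster K4).

THE POINT.  ROADS 1 and 2 close node N22 only under a condition tying the tower rate `θ` (or the per-step contraction `ω`) to the GROWTH of
the regularity letter with the age: `ω + c < 1` (N2), `θμ ≤ τ²` (`N22Knit`), `θν ≤ τ²` (`N22KnitDiscrete`∕`Recursion`), `θ < τ²` even for the
analytic branch with NO growth (`N22KnitAnalytic`) — the square root being an artefact of the REAL-variable Landau–Kolmogorov interpolation.
Interpolating in the complex plane (`BalabanUVNodesN22KnitThreeLines`: Hadamard's three lines on a disc; the knit announced there as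
`…AnalyticFading` is §3 of THIS file) gives instead:
* §1 `norm_deriv_deriv_le` (two nested Cauchy estimates: `‖G″(0)‖ ≤ Φ∕ρ₀²` from `‖G − c‖ ≤ Φ` on `D̄(0, 2ρ₀)`), `deriv_deriv_comp_sq`
  (`(F(x₀ + σζ²))″(0) = 2σF′(x₀)`).
* §2 **`norm_deriv_le_twoConstants_oneSided`** — `F` analytic on `D(x₀, R)` with `‖F‖ ≤ B`, flat on ONE side, `|F(x₀ ± u) − F(x₀)| ≤ ε` for
  `u ∈ [0, r]` (`r < R`), `0 < ε ≤ 2B`, `0 < s < 1` ⟹ `‖F′(x₀)‖ ≤ (32∕(s²r))·ε^{1−s}·(2B)^{s}` (the squaring `G(ζ) = F(x₀ ± ζ²)` turns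
  one-sided flatness into flatness on a diameter — needed because the coupling window `]0, γ]` is flat on one side only near its ends).
* §3 ON THE ABSTRACT CARRIERS: `coordLipschitzOn_of_osc_analytic_rpow` — (O) oscillation fading (`C₀θ^{age}`, `0 < θ`) + coordinate-disc
  analyticity with a uniform margin `r` about the window and bounds `M·μ^{age}·e^{−κd(X)}` (`θ ≤ μ`, `C₀ ≤ 2M` — enlarge `M`, `μ` if needed) ⟹
  pv10's `CoordLipschitzOn ]0, γ]` with FADING moduli `Λ k i = C₉·τ_s^{k−i}`, `τ_s = θ^{1−s}μ^{s}`, `C₉ = 32·C₀^{1−s}(2M)^{s}∕(s²·r₁·τ_s)`,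
  `r₁ = min(r∕2, γ∕2)`, for EVERY `s ∈ ]0, 1[`; **`ne9_and_fadingMemory_of_osc_analytic_rpow`** — with (P): **`NE9 E (Window γ) κ Λ ∧
  FadingMemory C₉ τ_s Λ`**, node N22's statement of record BY NAME; `ne9_fadingMemory_at_level_of_ne5_below_analytic` — along ne9's tower of
  carriers with node N18 BY NAME at the run lengths below the level.  READING: `τ_s ↓ θ` as `s ↓ 0`, for ANY `μ`: on ROAD 3 the GROWTH OF
  THE REGULARITY CONSTANTS IS IRRELEVANT — every fading rate above N18's `θ` is available; the only E-side input is the printed TYPE «(or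
  analytic)» ([Balaban1987RG1] p. 263) in each young coupling, uniform complex margin, at-most-geometric bounds (unprinted for the older
  couplings, as always; pv10's vertex verdict — relative radii only under (2.9), `T4CouplingAnalyticity` (W1)∕(L2) — applies here exactly as to
  `N22KnitAnalytic`).  On the (2.13) body the analytic tower in an OLDER coupling keeps a FIXED strip (the argument of `∫χe^{F}` with
  `|Im F| ≤ Φ < π∕2` stays in `[−Φ, Φ]`), so `μ` there never enters the rate.

References (TYPES only): [Balaban1987RG1] = T. Bałaban, Commun. Math. Phys. **109** (1987) 249–301 — p. 256, Thm 1 p. 259, (1.18) and the C^∞ ∕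
analytic clause p. 263, (2.9) p. 266, (2.13) p. 268, p. 298.
-/

noncomputable section

namespace Summit.QuantumFields.YangMills.BalabanUVNodes.N22KnitTwoConstants

open Set Metric Complex Real Filter
open scoped Real Topology
open Summit.QuantumFields.YangMills.BalabanUVNodes.N22KnitThreeLines (box_bound)

/-! ## §1 Two nested Cauchy estimates; the squaring chain rule -/

/-- **`‖G″(0)‖ ≤ Φ∕ρ₀²`** from `‖G − c‖ ≤ Φ` on `D̄(0, 2ρ₀)` (`G` complex-differentiable on `D(0, R_g)`, `2ρ₀ < R_g`): Cauchy's estimate for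
`G − c` on the circles of radius `ρ₀` about the points of the sphere of radius `ρ₀`, then for `G′` on that sphere. [folklore] -/
theorem norm_deriv_deriv_le {G : ℂ → ℂ} {c : ℂ} {Rg ρ₀ Φ : ℝ} (hρ₀ : 0 < ρ₀) (hρR : 2 * ρ₀ < Rg)
    (hG : DifferentiableOn ℂ G (ball (0 : ℂ) Rg)) (hΦ : ∀ z ∈ closedBall (0 : ℂ) (2 * ρ₀), ‖G z - c‖ ≤ Φ) :
    ‖deriv (deriv G) 0‖ ≤ Φ / ρ₀ ^ 2 := by
  have h1 : ∀ ζ ∈ sphere (0 : ℂ) ρ₀, ‖deriv G ζ‖ ≤ Φ / ρ₀ := by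
    intro ζ hζ
    rw [mem_sphere, dist_zero_right] at hζ
    have hsub : closedBall ζ ρ₀ ⊆ ball (0 : ℂ) Rg := by
      intro z hz
      rw [mem_closedBall, dist_eq_norm] at hz
      rw [mem_ball, dist_zero_right]
      calc ‖z‖ ≤ ‖z - ζ‖ + ‖ζ‖ := norm_le_norm_sub_add _ _
        _ ≤ ρ₀ + ρ₀ := add_le_add hz hζ.le
        _ < Rg := by linarith
    have hdc : DiffContOnCl ℂ (fun z => G z - c) (ball ζ ρ₀) := (hG.sub_const c).diffContOnCl_ball hsub
    have hC : ∀ z ∈ sphere ζ ρ₀, ‖G z - c‖ ≤ Φ := by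
      intro z hz
      refine hΦ z ?_
      rw [mem_sphere, dist_eq_norm] at hz
      rw [mem_closedBall, dist_zero_right]
      calc ‖z‖ ≤ ‖z - ζ‖ + ‖ζ‖ := norm_le_norm_sub_add _ _
        _ = 2 * ρ₀ := by rw [hz, hζ]; ring
    have h := Complex.norm_deriv_le_of_forall_mem_sphere_norm_le hρ₀ hdc hC
    have hd : deriv (fun z => G z - c) ζ = deriv G ζ := deriv_sub_const c
    rwa [hd] at h
  have hG' : DifferentiableOn ℂ (deriv G) (ball (0 : ℂ) Rg) := (hG.analyticOnNhd isOpen_ball).deriv.differentiableOn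
  have hsub0 : closedBall (0 : ℂ) ρ₀ ⊆ ball (0 : ℂ) Rg := closedBall_subset_ball (by linarith)
  have h2 := Complex.norm_deriv_le_of_forall_mem_sphere_norm_le hρ₀ (hG'.diffContOnCl_ball hsub0) h1
  calc ‖deriv (deriv G) 0‖ ≤ Φ / ρ₀ / ρ₀ := h2
    _ = Φ / ρ₀ ^ 2 := by rw [div_div, sq]

/-- **THE SQUARING CHAIN RULE**: for `F` complex-differentiable on `D(x₀, R)` and a sign `σ = ±1` (any `σ` with `‖σ‖ ≤ 1`),
`(ζ ↦ F(x₀ + σζ²))″(0) = 2σ·F′(x₀)`. [folklore] -/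
theorem deriv_deriv_comp_sq {F : ℂ → ℂ} {x₀ sg : ℂ} {R : ℝ} (hR : 0 < R) (hsg : ‖sg‖ ≤ 1)
    (hF : DifferentiableOn ℂ F (ball x₀ R)) :
    deriv (deriv (fun ζ : ℂ => F (x₀ + sg * ζ ^ 2))) 0 = 2 * sg * deriv F x₀ := by
  set S : Set ℂ := ball (0 : ℂ) (min 1 R) with hS
  have hS0 : (0 : ℂ) ∈ S := mem_ball_self (lt_min one_pos hR)
  have hinner : ∀ ζ ∈ S, x₀ + sg * ζ ^ 2 ∈ ball x₀ R := by
    intro ζ hζ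
    rw [hS, mem_ball, dist_zero_right, lt_min_iff] at hζ
    rw [mem_ball, dist_eq_norm, add_sub_cancel_left, norm_mul, norm_pow]
    have h1 : ‖ζ‖ ^ 2 ≤ ‖ζ‖ := by nlinarith [norm_nonneg ζ, hζ.1]
    calc ‖sg‖ * ‖ζ‖ ^ 2 ≤ 1 * ‖ζ‖ := mul_le_mul hsg h1 (sq_nonneg _) zero_le_one
      _ < R := by rw [one_mul]; exact hζ.2
  have hin : ∀ ζ : ℂ, HasDerivAt (fun ζ : ℂ => x₀ + sg * ζ ^ 2) (sg * (2 * ζ)) ζ := by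
    intro ζ
    have h := ((hasDerivAt_pow 2 ζ).const_mul sg).const_add x₀
    simpa [pow_one] using h
  have hderiv : ∀ ζ ∈ S, HasDerivAt (fun ζ : ℂ => F (x₀ + sg * ζ ^ 2)) (deriv F (x₀ + sg * ζ ^ 2) * (sg * (2 * ζ))) ζ := by
    intro ζ hζ
    have hFat : HasDerivAt F (deriv F (x₀ + sg * ζ ^ 2)) (x₀ + sg * ζ ^ 2) :=
      (hF.differentiableAt (isOpen_ball.mem_nhds (hinner ζ hζ))).hasDerivAt
    exact hFat.comp ζ (hin ζ)
  have heq : deriv (fun ζ : ℂ => F (x₀ + sg * ζ ^ 2)) =ᶠ[𝓝 0] fun ζ => deriv F (x₀ + sg * ζ ^ 2) * (sg * (2 * ζ)) :=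
    Filter.eventuallyEq_of_mem (isOpen_ball.mem_nhds hS0) fun ζ hζ => (hderiv ζ hζ).deriv
  rw [heq.deriv_eq]
  have hF' : DifferentiableOn ℂ (deriv F) (ball x₀ R) := (hF.analyticOnNhd isOpen_ball).deriv.differentiableOn
  have hx₀ : x₀ + sg * (0 : ℂ) ^ 2 = x₀ := by simp
  have hφ : DifferentiableAt ℂ (fun ζ : ℂ => deriv F (x₀ + sg * ζ ^ 2)) 0 := by
    have h1 : DifferentiableAt ℂ (deriv F) (x₀ + sg * (0 : ℂ) ^ 2) := by
      rw [hx₀]; exact hF'.differentiableAt (isOpen_ball.mem_nhds (mem_ball_self hR))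
    exact h1.comp 0 (hin 0).differentiableAt
  have hψ : HasDerivAt (fun ζ : ℂ => sg * (2 * ζ)) (sg * 2) 0 := by
    simpa using ((hasDerivAt_id (0 : ℂ)).const_mul (2 : ℂ)).const_mul sg
  have hprod := hφ.hasDerivAt.mul hψ
  have hfun : (fun ζ : ℂ => deriv F (x₀ + sg * ζ ^ 2) * (sg * (2 * ζ)))
      = (fun ζ : ℂ => deriv F (x₀ + sg * ζ ^ 2)) * fun ζ : ℂ => sg * (2 * ζ) := rfl
  rw [hfun, hprod.deriv]
  simp
  ring

/-! ## §2 The one-sided two-constants derivative bound -/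

/-- **THE TWO-CONSTANTS DERIVATIVE BOUND, ONE-SIDED FLATNESS.**  `F` complex-differentiable on the disc `D(x₀, R)` (`x₀` real) with
`‖F‖ ≤ B` there; on ONE side of `x₀` along the real axis, `|F(x₀ + σu) − F(x₀)| ≤ ε` for `u ∈ [0, r]` (`σ = 1` or `σ = −1`, `0 < r < R`);
`0 < ε ≤ 2B`; `0 < s < 1`.  Then **`‖F′(x₀)‖ ≤ (32∕(s²·r))·ε^{1−s}·(2B)^{s}`**.  (Squaring `G(ζ) = F(x₀ + σζ²)` makes the flat set the
two-sided diameter `[−√r, √r]`; `box_bound` + `norm_deriv_deriv_le` with `ρ₀ = √r·s∕8` + `deriv_deriv_comp_sq`.)  With `s = 1∕log(2B∕ε)`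
this is the classical `ε·log²(2B∕ε)∕r` at an end-point. [folklore] -/
theorem norm_deriv_le_twoConstants_oneSided {F : ℂ → ℂ} {x₀ r R B ε s σ : ℝ} (hσ : σ = 1 ∨ σ = -1)
    (hr : 0 < r) (hrR : r < R) (hs0 : 0 < s) (hs1 : s < 1) (hε : 0 < ε) (hεB : ε ≤ 2 * B)
    (hF : DifferentiableOn ℂ F (ball (x₀ : ℂ) R)) (hB : ∀ z ∈ ball (x₀ : ℂ) R, ‖F z‖ ≤ B)
    (hflat : ∀ u : ℝ, 0 ≤ u → u ≤ r → ‖F ((x₀ + σ * u : ℝ) : ℂ) - F x₀‖ ≤ ε) :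
    ‖deriv F x₀‖ ≤ 32 / (s ^ 2 * r) * ε ^ (1 - s) * (2 * B) ^ s := by
  have hσ1 : ‖(σ : ℂ)‖ ≤ 1 := by
    rw [Complex.norm_real, Real.norm_eq_abs]; rcases hσ with h | h <;> simp [h]
  have hσabs : |σ| = 1 := by rcases hσ with h | h <;> simp [h]
  set G : ℂ → ℂ := fun ζ => F ((x₀ : ℂ) + (σ : ℂ) * ζ ^ 2) with hGdef
  set L : ℝ := Real.sqrt r with hL
  have hL0 : 0 < L := Real.sqrt_pos.mpr hr
  have hLsq : L ^ 2 = r := Real.sq_sqrt hr.le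
  set Rg : ℝ := Real.sqrt R with hRg
  have hLRg : L < Rg := Real.sqrt_lt_sqrt hr.le hrR
  have hinner : ∀ ζ : ℂ, ‖ζ‖ < Rg → (x₀ : ℂ) + (σ : ℂ) * ζ ^ 2 ∈ ball (x₀ : ℂ) R := by
    intro ζ hζ
    rw [mem_ball, dist_eq_norm, add_sub_cancel_left, norm_mul, norm_pow]
    have hζ2 : ‖ζ‖ ^ 2 < R := by
      have h0 : 0 ≤ ‖ζ‖ := norm_nonneg ζ
      have : ‖ζ‖ ^ 2 < Rg ^ 2 := by nlinarith
      rwa [hRg, Real.sq_sqrt (hr.le.trans hrR.le)] at this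
    calc ‖(σ : ℂ)‖ * ‖ζ‖ ^ 2 ≤ 1 * ‖ζ‖ ^ 2 := mul_le_mul_of_nonneg_right hσ1 (sq_nonneg _)
      _ < R := by rw [one_mul]; exact hζ2
  have hG : DifferentiableOn ℂ G (ball (0 : ℂ) Rg) := by
    intro ζ hζ
    rw [mem_ball, dist_zero_right] at hζ
    have hFat : DifferentiableAt ℂ F ((x₀ : ℂ) + (σ : ℂ) * ζ ^ 2) := hF.differentiableAt (isOpen_ball.mem_nhds (hinner ζ hζ))
    exact (hFat.comp ζ (((differentiableAt_id.pow 2).const_mul _).const_add _)).differentiableWithinAt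
  have hK : ∀ z ∈ closedBall (0 : ℂ) L, ‖G z - F x₀‖ ≤ 2 * B := by
    intro z hz
    rw [mem_closedBall, dist_zero_right] at hz
    have h1 : ‖G z‖ ≤ B := hB _ (hinner z (hz.trans_lt hLRg))
    have h2 : ‖F x₀‖ ≤ B := hB _ (mem_ball_self (hr.trans hrR))
    calc ‖G z - F x₀‖ ≤ ‖G z‖ + ‖F (x₀ : ℂ)‖ := norm_sub_le _ _
      _ ≤ B + B := add_le_add h1 h2
      _ = 2 * B := by ring
  have hflatG : ∀ η : ℝ, |η| ≤ L → ‖G η - F x₀‖ ≤ ε := by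
    intro η hη
    have hη2 : η ^ 2 ≤ r := by
      have : |η| ^ 2 ≤ L ^ 2 := by nlinarith [abs_nonneg η]
      rwa [sq_abs, hLsq] at this
    have h := hflat (η ^ 2) (sq_nonneg η) hη2
    have e : G η = F ((x₀ + σ * η ^ 2 : ℝ) : ℂ) := by
      show F _ = F _
      push_cast
      rfl
    rwa [e]
  set ρ₀ : ℝ := L * s / 8 with hρ₀
  have hρ₀0 : 0 < ρ₀ := by positivity
  have hΦ : ∀ z ∈ closedBall (0 : ℂ) (2 * ρ₀), ‖G z - F x₀‖ ≤ ε ^ (1 - s) * (2 * B) ^ s := by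
    intro z hz
    rw [mem_closedBall, dist_zero_right] at hz
    have hre : |z.re| ≤ L / 2 := by
      refine (Complex.abs_re_le_norm z).trans (hz.trans ?_)
      rw [hρ₀]; nlinarith
    have him : |z.im| ≤ L * s / 4 := by
      refine (Complex.abs_im_le_norm z).trans (hz.trans ?_)
      rw [hρ₀]; nlinarith
    exact box_bound hL0 hLRg hG hK hflatG hε hεB hs1 hre him
  have h2ρ : 2 * ρ₀ < Rg := by
    have : 2 * ρ₀ < L := by rw [hρ₀]; nlinarith
    exact this.trans hLRg
  have hGG := norm_deriv_deriv_le hρ₀0 h2ρ hG hΦ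
  have hchain : deriv (deriv G) 0 = 2 * (σ : ℂ) * deriv F x₀ := deriv_deriv_comp_sq (hr.trans hrR) hσ1 hF
  rw [hchain, norm_mul, norm_mul, Complex.norm_real, Real.norm_eq_abs, hσabs, mul_one, Complex.norm_two] at hGG
  have hρ₀sq : ρ₀ ^ 2 = r * s ^ 2 / 64 := by
    rw [hρ₀, div_pow, mul_pow, hLsq]; ring
  rw [hρ₀sq] at hGG
  have hΦ0 : 0 ≤ ε ^ (1 - s) * (2 * B) ^ s := by
    have : 0 ≤ 2 * B := by linarith
    positivity
  calc ‖deriv F (x₀ : ℂ)‖ = (2 * ‖deriv F (x₀ : ℂ)‖) / 2 := by ring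
    _ ≤ (ε ^ (1 - s) * (2 * B) ^ s / (r * s ^ 2 / 64)) / 2 := by gcongr
    _ = 32 / (s ^ 2 * r) * ε ^ (1 - s) * (2 * B) ^ s := by field_simp; ring

/-! ## §3 On the abstract carriers: node N22 from (P) + (O) + analyticity with bounds growing at ANY geometric rate -/

section Abstract

open Literature.MathematicalPhysics.QuantumFieldTheory.Balaban1983to89
open Literature.MathematicalPhysics.QuantumFieldTheory.Balaban1983to89.T4OutputRate
open Literature.MathematicalPhysics.QuantumFieldTheory.Balaban1983to89.T4CouplingAnalyticity
  (CoordLipschitzOn update_mem_boxWindow ne9_of_coordLipschitz)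
open Summit.QuantumFields.YangMills.BalabanUVNodes.N22Knit (fadingMemory_geometric)
open Summit.QuantumFields.YangMills.BalabanUVNodes.N22KnitFiniteTower (oscFading_of_ne5_below)
open Summit.QuantumFields.BalabanUV.T4Continuum.NE9.TowerCarriers (TowerData prepend)

/-- The interpolated constants factor: `(C₀θ^{a}w)^{1−s}·(2Mμ^{a}w)^{s} = C₀^{1−s}(2M)^{s}·(θ^{1−s}μ^{s})^{a}·w` (positive bases). [folklore] -/
theorem interp_geometric {C₀ M θ μ w s : ℝ} (hC₀ : 0 < C₀) (hM : 0 < M) (hθ : 0 < θ) (hμ : 0 < μ) (hw : 0 < w) (a : ℕ) :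
    (C₀ * θ ^ a * w) ^ (1 - s) * (2 * M * μ ^ a * w) ^ s
      = C₀ ^ (1 - s) * (2 * M) ^ s * (θ ^ (1 - s) * μ ^ s) ^ a * w := by
  have hθa : 0 < θ ^ a := pow_pos hθ a
  have hμa : 0 < μ ^ a := pow_pos hμ a
  have e1 : (θ ^ a) ^ (1 - s) = (θ ^ (1 - s)) ^ a := by
    rw [← Real.rpow_natCast θ a, ← Real.rpow_mul hθ.le, mul_comm, Real.rpow_mul hθ.le, Real.rpow_natCast]
  have e2 : (μ ^ a) ^ s = (μ ^ s) ^ a := by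
    rw [← Real.rpow_natCast μ a, ← Real.rpow_mul hμ.le, mul_comm, Real.rpow_mul hμ.le, Real.rpow_natCast]
  have e3 : w ^ (1 - s) * w ^ s = w := by
    rw [← Real.rpow_add hw, sub_add_cancel, Real.rpow_one]
  rw [Real.mul_rpow (by positivity : (0 : ℝ) ≤ C₀ * θ ^ a) hw.le, Real.mul_rpow hC₀.le hθa.le,
    Real.mul_rpow (by positivity : (0 : ℝ) ≤ 2 * M * μ ^ a) hw.le, Real.mul_rpow (by positivity : (0 : ℝ) ≤ 2 * M) hμa.le, e1, e2]
  calc C₀ ^ (1 - s) * (θ ^ (1 - s)) ^ a * w ^ (1 - s) * ((2 * M) ^ s * (μ ^ s) ^ a * w ^ s)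
      = C₀ ^ (1 - s) * (2 * M) ^ s * ((θ ^ (1 - s)) ^ a * (μ ^ s) ^ a) * (w ^ (1 - s) * w ^ s) := by ring
    _ = C₀ ^ (1 - s) * (2 * M) ^ s * (θ ^ (1 - s) * μ ^ s) ^ a * w := by rw [e3, ← mul_pow]

variable {C : Carriers} {Bg : Type} {E : Functional C Bg}

/-- **(O) + UNIFORM-MARGIN ANALYTICITY WITH GEOMETRIC GROWTH ⇒ COORDINATEWISE FADING LIPSCHITZ MODULI AT THE RATE `θ^{1−s}μ^{s}`.**  (O)
oscillation fading with constant `C₀ > 0` and rate `θ > 0`; (A) every young-coupling section `t ↦ E (update g i t) U X` on `]0, γ]` extends to a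
complex-analytic `F` on a set containing the closed discs of radius `r` about the points of `]0, γ]`, with `‖F‖ ≤ M·μ^{scale X − 1 − i}·e^{−κd(X)}`
there (`θ ≤ μ`, `C₀ ≤ 2M`: enlarge `M`, `μ` if needed).  Then for every `s ∈ ]0, 1[`: `CoordLipschitzOn ]0, γ] E κ Λ`, `Λ k i = C₉·τ_s^{k−i}`,
`τ_s = θ^{1−s}μ^{s}`, `C₉ = (32∕(s²·r₁))·C₀^{1−s}(2M)^{s}∕τ_s`, `r₁ = min(r∕2, γ∕2)` — §2 at every point of the window, one-sided towards the
interior, then the mean value inequality. [folklore] -/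
theorem coordLipschitzOn_of_osc_analytic_rpow {γ κ C₀ θ M μ r s : ℝ}
    (hO : ∀ g ∈ Window γ, ∀ g' ∈ Window γ, ∀ (U : Bg) (X : C.Dom) (a : ℕ), a ≤ C.scale X →
      (∀ n, a ≤ n → g n = g' n) → |E g U X - E g' U X| ≤ C₀ * θ ^ (C.scale X - a) * Real.exp (-(κ * C.d X)))
    (hA : ∀ g ∈ Window γ, ∀ (U : Bg) (X : C.Dom) (i : ℕ), i < C.scale X → ∃ (F : ℂ → ℂ) (D : Set ℂ),
      DifferentiableOn ℂ F D ∧ (∀ z ∈ D, ‖F z‖ ≤ M * μ ^ (C.scale X - 1 - i) * Real.exp (-(κ * C.d X))) ∧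
      (∀ t ∈ Ioc (0 : ℝ) γ, closedBall (t : ℂ) r ⊆ D) ∧ (∀ t ∈ Ioc (0 : ℝ) γ, F t = (E (Function.update g i t) U X : ℂ)))
    (hC₀ : 0 < C₀) (hθ : 0 < θ) (hM : 0 < M) (hθμ : θ ≤ μ) (hCM : C₀ ≤ 2 * M) (hr : 0 < r) (hγ : 0 < γ) (hs0 : 0 < s) (hs1 : s < 1) :
    CoordLipschitzOn (Ioc (0 : ℝ) γ) E κ
      (fun k i => 32 / (s ^ 2 * min (r / 2) (γ / 2)) * (C₀ ^ (1 - s) * (2 * M) ^ s) / (θ ^ (1 - s) * μ ^ s)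
        * (θ ^ (1 - s) * μ ^ s) ^ (k - i)) := by
  intro U X g hg i hi s₁ hs₁ s₂ hs₂
  set a : ℕ := C.scale X - 1 - i with ha
  set w : ℝ := Real.exp (-(κ * C.d X)) with hw
  have hw0 : 0 < w := Real.exp_pos _
  have hμ : 0 < μ := hθ.trans_le hθμ
  set τ : ℝ := θ ^ (1 - s) * μ ^ s with hτ
  have hτ0 : 0 < τ := mul_pos (Real.rpow_pos_of_pos hθ _) (Real.rpow_pos_of_pos hμ _)
  set r₁ : ℝ := min (r / 2) (γ / 2) with hr₁
  have hr₁0 : 0 < r₁ := lt_min (by linarith) (by linarith)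
  have hr₁r : r₁ < r := (min_le_left _ _).trans_lt (by linarith)
  have hr₁γ : 2 * r₁ ≤ γ := by have := min_le_right (r / 2) (γ / 2); linarith
  set ε : ℝ := C₀ * θ ^ a * w with hε
  set B : ℝ := M * μ ^ a * w with hB
  have hε0 : 0 < ε := by positivity
  have hεB : ε ≤ 2 * B := by
    have h1 : θ ^ a ≤ μ ^ a := pow_le_pow_left₀ hθ.le hθμ a
    have h2 : C₀ * θ ^ a ≤ 2 * M * μ ^ a := mul_le_mul hCM h1 (pow_nonneg hθ.le a) (by linarith)
    calc ε = C₀ * θ ^ a * w := rfl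
      _ ≤ 2 * M * μ ^ a * w := mul_le_mul_of_nonneg_right h2 hw0.le
      _ = 2 * B := by rw [hB]; ring
  obtain ⟨F, D, hF, hFB, hD, hf⟩ := hA g hg U X i hi
  set f : ℝ → ℝ := fun t => E (Function.update g i t) U X with hfdef
  have hflat : ∀ x ∈ Ioc (0 : ℝ) γ, ∀ y ∈ Ioc (0 : ℝ) γ, |f x - f y| ≤ ε := by
    intro x hx y hy
    have hagree : ∀ n, i + 1 ≤ n → Function.update g i x n = Function.update g i y n := fun n hn => by
      have hni : n ≠ i := by omega
      rw [Function.update_of_ne hni, Function.update_of_ne hni]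
    have h := hO _ (update_mem_boxWindow hg i hx) _ (update_mem_boxWindow hg i hy) U X (i + 1) (by omega) hagree
    rwa [show C.scale X - (i + 1) = a by omega] at h
  set Lip : ℝ := 32 / (s ^ 2 * r₁) * ε ^ (1 - s) * (2 * B) ^ s with hLip
  have hderiv : ∀ t ∈ Ioc (0 : ℝ) γ, ‖deriv F t‖ ≤ Lip := by
    intro t ht
    have hball : ball (t : ℂ) r ⊆ D := ball_subset_closedBall.trans (hD t ht)
    have hFt : DifferentiableOn ℂ F (ball (t : ℂ) r) := hF.mono hball
    have hBt : ∀ z ∈ ball (t : ℂ) r, ‖F z‖ ≤ B := fun z hz => hFB z (hball hz)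
    by_cases htr : t + r₁ ≤ γ
    · refine norm_deriv_le_twoConstants_oneSided (σ := 1) (Or.inl rfl) hr₁0 hr₁r hs0 hs1 hε0 hεB hFt hBt fun u hu0 hur => ?_
      have hmem : t + 1 * u ∈ Ioc (0 : ℝ) γ := ⟨by linarith [ht.1], by linarith⟩
      rw [hf _ hmem, hf _ ht, ← Complex.ofReal_sub, Complex.norm_real, Real.norm_eq_abs]
      exact hflat _ hmem _ ht
    · have htr : γ < t + r₁ := not_le.mp htr
      refine norm_deriv_le_twoConstants_oneSided (σ := -1) (Or.inr rfl) hr₁0 hr₁r hs0 hs1 hε0 hεB hFt hBt fun u hu0 hur => ?_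
      have hmem : t + -1 * u ∈ Ioc (0 : ℝ) γ := ⟨by linarith, by linarith [ht.2]⟩
      rw [hf _ hmem, hf _ ht, ← Complex.ofReal_sub, Complex.norm_real, Real.norm_eq_abs]
      exact hflat _ hmem _ ht
  have hfd : ∀ t ∈ Ioc (0 : ℝ) γ, HasDerivWithinAt f ((deriv F t).re) (Ioc (0 : ℝ) γ) t := by
    intro t ht
    have hDt : D ∈ 𝓝 (t : ℂ) :=
      mem_nhds_iff.mpr ⟨ball (t : ℂ) r, ball_subset_closedBall.trans (hD t ht), isOpen_ball, mem_ball_self hr⟩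
    have h1 : HasDerivAt F (deriv F t) (t : ℂ) := (hF.differentiableAt hDt).hasDerivAt
    have h2 : HasDerivAt (fun x : ℝ => (F x).re) (deriv F t).re t := h1.real_of_complex
    refine h2.hasDerivWithinAt.congr (fun x hx => ?_) ?_
    · show f x = (F x).re
      rw [hf x hx, Complex.ofReal_re]
    · show f t = (F t).re
      rw [hf t ht, Complex.ofReal_re]
  have hmv : ∀ x y : ℝ, x ∈ Ioc (0 : ℝ) γ → y ∈ Ioc (0 : ℝ) γ → x ≤ y → |f y - f x| ≤ Lip * (y - x) := by
    intro x y hx hy hxy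
    have hsub : Icc x y ⊆ Ioc (0 : ℝ) γ := fun z hz => ⟨hx.1.trans_le hz.1, hz.2.trans hy.2⟩
    have h := norm_image_sub_le_of_norm_deriv_le_segment' (f := f) (f' := fun t => (deriv F t).re)
      (fun z hz => (hfd z (hsub hz)).mono hsub)
      (fun z hz => ((Complex.abs_re_le_norm _).trans (hderiv z (hsub (Ico_subset_Icc_self hz)))))
      y (right_mem_Icc.mpr hxy)
    rw [Real.norm_eq_abs] at h
    exact h
  have hmain : |f s₁ - f s₂| ≤ Lip * |s₁ - s₂| := by
    rcases le_total s₁ s₂ with h | h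
    · rw [abs_sub_comm (f s₁) (f s₂), abs_sub_comm s₁ s₂, abs_of_nonneg (sub_nonneg.mpr h)]
      exact hmv s₁ s₂ hs₁ hs₂ h
    · rw [abs_of_nonneg (sub_nonneg.mpr h)]
      exact hmv s₂ s₁ hs₂ hs₁ h
  have hscale : C.scale X - i = a + 1 := by omega
  have hLipeq : Lip = w * (32 / (s ^ 2 * r₁) * (C₀ ^ (1 - s) * (2 * M) ^ s) / τ * τ ^ (C.scale X - i)) := by
    rw [hLip, hscale, pow_succ τ a, hε, show 2 * B = 2 * M * μ ^ a * w by rw [hB]; ring, mul_assoc (32 / (s ^ 2 * r₁)),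
      interp_geometric hC₀ hM hθ hμ hw0 a]
    field_simp
    ring
  show |f s₁ - f s₂| ≤ w * (32 / (s ^ 2 * r₁) * (C₀ ^ (1 - s) * (2 * M) ^ s) / τ * τ ^ (C.scale X - i) * |s₁ - s₂|)
  calc |f s₁ - f s₂| ≤ Lip * |s₁ - s₂| := hmain
    _ = w * (32 / (s ^ 2 * r₁) * (C₀ ^ (1 - s) * (2 * M) ^ s) / τ * τ ^ (C.scale X - i) * |s₁ - s₂|) := by
        rw [hLipeq]; ring

/-- **ROAD 3 HEADLINE — NODE N22 FROM (P) + (O) + ANALYTICITY WITH BOUNDS GROWING AT ANY GEOMETRIC RATE.**  (P) prefix dependence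
([Balaban1987RG1] p. 256, words); (O) oscillation fading with constant `C₀ > 0` at the tower rate `θ > 0` (= node N18 along the tower, NOT
PRINTED); (A) uniform-margin coordinate-disc analyticity of the young-coupling sections around `]0, γ]` with bounds `M·μ^{age−1}·e^{−κd(X)}`, ANY
`μ ≥ θ` (the TYPE of p. 263's «(or analytic)», unprinted for the older couplings; `C₀ ≤ 2M`).  Then for EVERY `s ∈ ]0, 1[`:
**`NE9 E (Window γ) κ Λ ∧ FadingMemory C₉ τ_s Λ`**, `Λ k i = C₉·τ_s^{k−i}`, `τ_s = θ^{1−s}μ^{s}`,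
`C₉ = (32∕(s²·min(r∕2, γ∕2)))·C₀^{1−s}(2M)^{s}∕τ_s` — node N22's statement of record BY NAME with fading at every rate above `θ` (`s ↓ 0`),
WHATEVER the growth `μ`: no E-side smallness and no growth condition; only node N18's `θ < 1` makes `τ_s < 1`. [folklore] -/
theorem ne9_and_fadingMemory_of_osc_analytic_rpow {γ κ C₀ θ M μ r s : ℝ} (hP : PrefixDependenceOn E (Window γ))
    (hO : ∀ g ∈ Window γ, ∀ g' ∈ Window γ, ∀ (U : Bg) (X : C.Dom) (a : ℕ), a ≤ C.scale X →
      (∀ n, a ≤ n → g n = g' n) → |E g U X - E g' U X| ≤ C₀ * θ ^ (C.scale X - a) * Real.exp (-(κ * C.d X)))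
    (hA : ∀ g ∈ Window γ, ∀ (U : Bg) (X : C.Dom) (i : ℕ), i < C.scale X → ∃ (F : ℂ → ℂ) (D : Set ℂ),
      DifferentiableOn ℂ F D ∧ (∀ z ∈ D, ‖F z‖ ≤ M * μ ^ (C.scale X - 1 - i) * Real.exp (-(κ * C.d X))) ∧
      (∀ t ∈ Ioc (0 : ℝ) γ, closedBall (t : ℂ) r ⊆ D) ∧ (∀ t ∈ Ioc (0 : ℝ) γ, F t = (E (Function.update g i t) U X : ℂ)))
    (hC₀ : 0 < C₀) (hθ : 0 < θ) (hM : 0 < M) (hθμ : θ ≤ μ) (hCM : C₀ ≤ 2 * M) (hr : 0 < r) (hγ : 0 < γ) (hs0 : 0 < s) (hs1 : s < 1) :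
    NE9 E (Window γ) κ
        (fun k i => 32 / (s ^ 2 * min (r / 2) (γ / 2)) * (C₀ ^ (1 - s) * (2 * M) ^ s) / (θ ^ (1 - s) * μ ^ s)
          * (θ ^ (1 - s) * μ ^ s) ^ (k - i)) ∧
      FadingMemory (32 / (s ^ 2 * min (r / 2) (γ / 2)) * (C₀ ^ (1 - s) * (2 * M) ^ s) / (θ ^ (1 - s) * μ ^ s))
        (θ ^ (1 - s) * μ ^ s)
        (fun k i => 32 / (s ^ 2 * min (r / 2) (γ / 2)) * (C₀ ^ (1 - s) * (2 * M) ^ s) / (θ ^ (1 - s) * μ ^ s)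
          * (θ ^ (1 - s) * μ ^ s) ^ (k - i)) := by
  have hμ : 0 < μ := hθ.trans_le hθμ
  have hτ0 : 0 < θ ^ (1 - s) * μ ^ s := mul_pos (Real.rpow_pos_of_pos hθ _) (Real.rpow_pos_of_pos hμ _)
  have hr₁0 : 0 < min (r / 2) (γ / 2) := lt_min (by linarith) (by linarith)
  have hC₉ : 0 ≤ 32 / (s ^ 2 * min (r / 2) (γ / 2)) * (C₀ ^ (1 - s) * (2 * M) ^ s) / (θ ^ (1 - s) * μ ^ s) := by
    have h1 : 0 ≤ C₀ ^ (1 - s) := Real.rpow_nonneg hC₀.le _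
    have h2 : 0 ≤ (2 * M) ^ s := Real.rpow_nonneg (by linarith) _
    positivity
  exact ⟨ne9_of_coordLipschitz hP (coordLipschitzOn_of_osc_analytic_rpow hO hA hC₀ hθ hM hθμ hCM hr hγ hs0 hs1),
    fadingMemory_geometric hC₉ hτ0.le⟩

/-- **ROAD 3 ALONG ne9's TOWER OF CARRIERS — NODE N22 FOR THE RUN OF LENGTH `k` FROM NODE N18 BELOW `k` + ANALYTICITY.**  `T4OutputRate.NE5`
at the pairs of run lengths `k′ < k` (node N18 BY NAME, the finite datum; `C₅ > 0`, `0 < θ < 1`) gives (O) at level `k` with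
`C₀ = 2C₅∕(1−θ)` (`N22KnitFiniteTower.oscFading_of_ne5_below`); with (P) and (A) for `E k` (bounds `M·μ^{(k − r X) − 1 − i}·e^{−κd(X)}`,
`μ ≥ θ`, `2C₅∕(1−θ) ≤ 2M`): for every `s ∈ ]0, 1[`, `NE9 (C := T.level k) (E k) (Window γ) κ Λ ∧ FadingMemory C₉ τ_s Λ`, `τ_s = θ^{1−s}μ^{s}`. [folklore] -/
theorem ne9_fadingMemory_at_level_of_ne5_below_analytic (T : TowerData) {E : ℕ → (ℕ → ℝ) → T.B → T.Dom → ℝ}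
    {γ κ θ C₅ M μ r s : ℝ} (hC : 0 < C₅) (hθ0 : 0 < θ) (hθ1 : θ < 1) (k : ℕ)
    (h5 : ∀ k' : ℕ, k' < k → ∀ b : ℝ, 0 < b → b ≤ γ →
      NE5 (C := T.level k') (E k') (fun g U X => E (k' + 1) (prepend b g) U X) (Window γ) κ θ C₅)
    (hP : PrefixDependenceOn (C := T.level k) (E k) (Window γ))
    (hA : ∀ g ∈ Window γ, ∀ (U : (T.level k).BgA) (X : (T.level k).Dom) (i : ℕ), i < (T.level k).scale X → ∃ (F : ℂ → ℂ) (D : Set ℂ),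
      DifferentiableOn ℂ F D ∧ (∀ z ∈ D, ‖F z‖ ≤ M * μ ^ ((T.level k).scale X - 1 - i) * Real.exp (-(κ * (T.level k).d X))) ∧
      (∀ t ∈ Ioc (0 : ℝ) γ, closedBall (t : ℂ) r ⊆ D) ∧ (∀ t ∈ Ioc (0 : ℝ) γ, F t = (E k (Function.update g i t) U X : ℂ)))
    (hM : 0 < M) (hθμ : θ ≤ μ) (hCM : 2 * C₅ / (1 - θ) ≤ 2 * M) (hr : 0 < r) (hγ : 0 < γ) (hs0 : 0 < s) (hs1 : s < 1) :
    NE9 (C := T.level k) (E k) (Window γ) κ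
        (fun k i => 32 / (s ^ 2 * min (r / 2) (γ / 2)) * ((2 * C₅ / (1 - θ)) ^ (1 - s) * (2 * M) ^ s) / (θ ^ (1 - s) * μ ^ s)
          * (θ ^ (1 - s) * μ ^ s) ^ (k - i)) ∧
      FadingMemory (32 / (s ^ 2 * min (r / 2) (γ / 2)) * ((2 * C₅ / (1 - θ)) ^ (1 - s) * (2 * M) ^ s) / (θ ^ (1 - s) * μ ^ s))
        (θ ^ (1 - s) * μ ^ s)
        (fun k i => 32 / (s ^ 2 * min (r / 2) (γ / 2)) * ((2 * C₅ / (1 - θ)) ^ (1 - s) * (2 * M) ^ s) / (θ ^ (1 - s) * μ ^ s)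
          * (θ ^ (1 - s) * μ ^ s) ^ (k - i)) := by
  have h1θ : 0 < 1 - θ := by linarith
  have hC₀ : 0 < 2 * C₅ / (1 - θ) := by positivity
  exact ne9_and_fadingMemory_of_osc_analytic_rpow (C := T.level k) hP (oscFading_of_ne5_below T hC.le hθ0.le hθ1 k h5) hA
    hC₀ hθ0 hM hθμ hCM hr hγ hs0 hs1

end Abstract


end Summit.QuantumFields.YangMills.BalabanUVNodes.N22KnitTwoConstants

end
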